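import Mathlib
import Summits.NavierStokesRegularity.NavierStokesRegularity.Theorems.TaoLadderRungThreeGappedFrontRobustComparison
import HarnessLib

/-!
# `GappedFrontRobust`, tools for the (step) clause: the DEVIATION BOUND over a window (helper for item
  stmt-NavierStokesRegularity-20423, crux K_B of routes TaoLadderRungThree / TaoLadderRungTwo /
  TaoLadderRungTwoPoly and its announced restatement over `GapData₂`)

HONEST FRAMING: an elementary real-analysis lemma about Tao-type MODEL lattice pseudo-flows (Tao 2016,
§4 Lemma 4.1 (4.8)), in the cell vocabulary `TaoCascade.PseudoFlowOn` / `quadTerm`; continuation of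
`…GappedFrontRobustComparison`. Nothing here is a statement about the Navier–Stokes equations, and
nothing is asserted about any table.

WHAT THIS IS FOR. `bootstrap_family` (in `…Comparison`) needs an IMPROVEMENT step: from the weak
deviation bounds `|S̃_{j,k} − S_{j,k}| ≤ D_k φ` on `[0, t]` (all shells) to a better bound at time `t`.
`pseudoFlowOn_deviation_le` is that step in closed form: the deviation of mode `(i, n)` at time `t` is
at most its start value plus the ROW SUM `R_{i,n} = ∑|α| Λ (D_a A_b + A_a D_b)` times `∫₀ᵗ φ` plus the
motion-defect integral. With weights making `R_{i,n} ≤ Γ D_n` and `φ = ψ₀ e^{4Γ·}` this closes the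
bootstrap on the shells at and behind the front and on the finitely many active shells ahead of it.
-/

noncomputable section

-- the sub-problem namespace `Summit.NavierStokesRegularity.NavierStokesRegularity` repeats the summit name by design (D-0017)
set_option linter.dupNamespace false

namespace Summit.NavierStokesRegularity.NavierStokesRegularity.Theorems

open Set MeasureTheory intervalIntegral Literature.Analysis.FluidPDE Literature.Analysis.FluidPDE.TaoCascade

namespace GappedFrontRobust

variable {m : ℕ}

variable {τ ε₀ : ℝ} {α : Fin m → Fin m → Fin m → ℤ × ℤ × ℤ → ℝ} {κ₁ κ₂ κ₂' : ℝ}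
  {S₀ F₀ B₀ S₀' F₀' B₀' : Fin m → ℤ → ℝ} {S F S' F' : Fin m → ℤ → ℝ → ℝ}

/-! ### The deviation bound over a window -/

/-- **DEVIATION BOUND OVER A WINDOW.** Let `S` (motion defect `κ₁`) and `S'` (defect-free) be
pseudo-flows on `[0, τ]` (`τ > 0`, `ε₀ > -1`) for the same table, from start states `S₀`, `S₀'`. Suppose
that on `[0, t]` (`t ∈ [0, τ]`) both families are bounded shell-wise, `|S_{j,k}(u)|, |S'_{j,k}(u)| ≤ A_k`,
and their difference is bounded by a fixed shell profile times a continuous time profile,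
`|S_{j,k}(u) − S'_{j,k}(u)| ≤ D_k φ(u)` (`φ` continuous on `[0, τ]`). Then for every mode
`i` and shell `n`,
`|(S − S')_{i,n}(t)| ≤ |(S₀ − S₀')_{i,n}| + R_{i,n} (∫₀ᵗ φ) + ∫₀ᵗ κ₁ (1+ε₀)^{2n} √F_{i,n}`,
with the ROW SUM `R_{i,n} = ∑_{i₁,i₂,μ∈S} |α_{i₁i₂iμ}| (1+ε₀)^{5(n−μ₃)/2} (D_a A_b + A_a D_b)`,
`a = n−μ₃+μ₁`, `b = n−μ₃+μ₂` (integral form of (4.8) for the difference + the bilinear bound). This is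
the step that improves the weak bound of `bootstrap_family` once the weights make `R_{i,n} ≤ Γ D_n`.
[cite: Tao2016AveragedNS, §4 Lemma 4.1 (4.8)] -/
theorem pseudoFlowOn_deviation_le (h : PseudoFlowOn τ ε₀ α κ₁ κ₂ S₀ F₀ B₀ S F)
    (h' : PseudoFlowOn τ ε₀ α 0 κ₂' S₀' F₀' B₀' S' F') (hτ : 0 < τ) (hε : 0 < 1 + ε₀)
    {t : ℝ} (ht : t ∈ Icc 0 τ) {A D : ℤ → ℝ} {φ : ℝ → ℝ} (hφ : ContinuousOn φ (Icc 0 τ))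
    (hA : ∀ u ∈ Icc 0 t, ∀ (j : Fin m) (k : ℤ), |S j k u| ≤ A k)
    (hA' : ∀ u ∈ Icc 0 t, ∀ (j : Fin m) (k : ℤ), |S' j k u| ≤ A k)
    (hD : ∀ u ∈ Icc 0 t, ∀ (j : Fin m) (k : ℤ), |S j k u - S' j k u| ≤ D k * φ u)
    (i : Fin m) (n : ℤ) :
    |S i n t - S' i n t| ≤ |S₀ i n - S₀' i n| +
      (∑ i₁, ∑ i₂, ∑ μ ∈ shiftSet, |α i₁ i₂ i μ| * (1 + ε₀) ^ ((5 : ℝ) * (n - μ.2.2) / 2) *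
        (D (n - μ.2.2 + μ.1) * A (n - μ.2.2 + μ.2.1) + A (n - μ.2.2 + μ.1) * D (n - μ.2.2 + μ.2.1))) *
        (∫ u in (0 : ℝ)..t, φ u) +
      ∫ u in (0 : ℝ)..t, κ₁ * (1 + ε₀) ^ ((2 : ℝ) * n) * Real.sqrt (F i n u) := by
  set R : ℝ := ∑ i₁, ∑ i₂, ∑ μ ∈ shiftSet, |α i₁ i₂ i μ| * (1 + ε₀) ^ ((5 : ℝ) * (n - μ.2.2) / 2) *
    (D (n - μ.2.2 + μ.1) * A (n - μ.2.2 + μ.2.1) + A (n - μ.2.2 + μ.1) * D (n - μ.2.2 + μ.2.1))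
    with hR
  have hsubI : Icc 0 t ⊆ Icc 0 τ := Icc_subset_Icc_right ht.2
  have hsub : uIcc 0 t ⊆ Icc 0 τ := by rwa [uIcc_of_le ht.1]
  -- the pointwise bilinear bound with the time profile factored out
  have hpt : ∀ u ∈ Icc 0 t, |quadTerm ε₀ α S i n u - quadTerm ε₀ α S' i n u| ≤ R * φ u := by
    intro u hu
    have hb := abs_quadTerm_sub_quadTerm_le ε₀ hε α S S' i n u (A := A)
      (D := fun k => D k * φ u) (hA u hu) (hA' u hu) (hD u hu)
    refine hb.trans (le_of_eq ?_)
    simp only [hR, Finset.sum_mul]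
    refine Finset.sum_congr rfl fun i₁ _ => Finset.sum_congr rfl fun i₂ _ =>
      Finset.sum_congr rfl fun μ _ => ?_
    ring
  -- integrability
  have hqc : ContinuousOn (fun u => quadTerm ε₀ α S i n u - quadTerm ε₀ α S' i n u) (Icc 0 τ) :=
    (pseudoFlowOn_continuousOn_quadTerm h i n).sub (pseudoFlowOn_continuousOn_quadTerm h' i n)
  have hqint : IntervalIntegrable (fun u => quadTerm ε₀ α S i n u - quadTerm ε₀ α S' i n u)
      volume 0 t := (hqc.mono hsub).intervalIntegrable
  have hRint : IntervalIntegrable (fun u => R * φ u) volume 0 t :=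
    ((continuousOn_const.mul hφ).mono hsub).intervalIntegrable
  -- |∫ Δq| ≤ ∫ |Δq| ≤ R ∫ φ
  have hI : |∫ u in (0 : ℝ)..t, (quadTerm ε₀ α S i n u - quadTerm ε₀ α S' i n u)| ≤
      R * ∫ u in (0 : ℝ)..t, φ u := by
    calc |∫ u in (0 : ℝ)..t, (quadTerm ε₀ α S i n u - quadTerm ε₀ α S' i n u)|
        ≤ ∫ u in (0 : ℝ)..t, |quadTerm ε₀ α S i n u - quadTerm ε₀ α S' i n u| :=
          intervalIntegral.abs_integral_le_integral_abs ht.1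
      _ ≤ ∫ u in (0 : ℝ)..t, R * φ u :=
          intervalIntegral.integral_mono_on ht.1 hqint.abs hRint fun u hu => hpt u hu
      _ = R * ∫ u in (0 : ℝ)..t, φ u := intervalIntegral.integral_const_mul _ _
  have hdiff := pseudoFlowOn_diff_integral h h' hτ i n ht
  -- triangle inequality
  have htri : |S i n t - S' i n t| ≤ |S₀ i n - S₀' i n| +
      |∫ u in (0 : ℝ)..t, (quadTerm ε₀ α S i n u - quadTerm ε₀ α S' i n u)| +
      |(S i n t - S' i n t) - (S₀ i n - S₀' i n) -
        ∫ u in (0 : ℝ)..t, (quadTerm ε₀ α S i n u - quadTerm ε₀ α S' i n u)| := by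
    have := abs_add_three (S₀ i n - S₀' i n)
      (∫ u in (0 : ℝ)..t, (quadTerm ε₀ α S i n u - quadTerm ε₀ α S' i n u))
      ((S i n t - S' i n t) - (S₀ i n - S₀' i n) -
        ∫ u in (0 : ℝ)..t, (quadTerm ε₀ α S i n u - quadTerm ε₀ α S' i n u))
    have heq : S₀ i n - S₀' i n +
        (∫ u in (0 : ℝ)..t, (quadTerm ε₀ α S i n u - quadTerm ε₀ α S' i n u)) +
        ((S i n t - S' i n t) - (S₀ i n - S₀' i n) -
          ∫ u in (0 : ℝ)..t, (quadTerm ε₀ α S i n u - quadTerm ε₀ α S' i n u)) =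
        S i n t - S' i n t := by ring
    rw [heq] at this
    exact this
  show |S i n t - S' i n t| ≤ |S₀ i n - S₀' i n| + R * (∫ u in (0 : ℝ)..t, φ u) +
      ∫ u in (0 : ℝ)..t, κ₁ * (1 + ε₀) ^ ((2 : ℝ) * n) * Real.sqrt (F i n u)
  linarith

/-! ### The row sum from three-shell maxima (appended by p1 g9: reduces `hrow` of the active zone to
scalar inequalities per shell) -/

/-- **Row sum from three-shell maxima**: if `A, D ≥ 0` with `A k ≤ Amax`, `D k ≤ Dmax` on the three shells
`n−1, n, n+1` (`ε₀ ≥ 0`), then the row sum of `pseudoFlowOn_deviation_le` obeys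
`R_{i,n} ≤ 2 (∑_{i₁,i₂,μ}|α_{i₁i₂iμ}|) (1+ε₀)^{5n/2} Amax · Dmax`.
[cite: Tao2016AveragedNS, §4 (4.8) (the bilinear term)] -/
theorem rowSum_le_of_le {ε₀ : ℝ} (hε : 0 ≤ ε₀) (α : Fin m → Fin m → Fin m → ℤ × ℤ × ℤ → ℝ) (i : Fin m)
    (n : ℤ) {A D : ℤ → ℝ} {Amax Dmax : ℝ} (hA0 : ∀ k, 0 ≤ A k) (hD0 : ∀ k, 0 ≤ D k)
    (hA3 : ∀ k, n - 1 ≤ k → k ≤ n + 1 → A k ≤ Amax) (hD3 : ∀ k, n - 1 ≤ k → k ≤ n + 1 → D k ≤ Dmax) :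
    ∑ i₁, ∑ i₂, ∑ μ ∈ shiftSet, |α i₁ i₂ i μ| * (1 + ε₀) ^ ((5 : ℝ) * (n - μ.2.2) / 2) *
        (D (n - μ.2.2 + μ.1) * A (n - μ.2.2 + μ.2.1) + A (n - μ.2.2 + μ.1) * D (n - μ.2.2 + μ.2.1)) ≤
      2 * (∑ i₁, ∑ i₂, ∑ μ ∈ shiftSet, |α i₁ i₂ i μ|) * (1 + ε₀) ^ ((5 : ℝ) * n / 2) * Amax * Dmax := by
  have hq : 0 < 1 + ε₀ := by linarith
  have hq1 : 1 ≤ 1 + ε₀ := by linarith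
  have hterm : ∀ (i₁ i₂ : Fin m), ∀ μ ∈ shiftSet,
      |α i₁ i₂ i μ| * (1 + ε₀) ^ ((5 : ℝ) * (n - μ.2.2) / 2) *
          (D (n - μ.2.2 + μ.1) * A (n - μ.2.2 + μ.2.1) +
            A (n - μ.2.2 + μ.1) * D (n - μ.2.2 + μ.2.1)) ≤
        |α i₁ i₂ i μ| * ((1 + ε₀) ^ ((5 : ℝ) * n / 2) * (2 * Amax * Dmax)) := by
    intro i₁ i₂ μ hμ
    have hμ' := (mem_shiftSet_iff μ).1 hμ
    have hab : n - 1 ≤ n - μ.2.2 + μ.1 ∧ n - μ.2.2 + μ.1 ≤ n + 1 ∧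
        n - 1 ≤ n - μ.2.2 + μ.2.1 ∧ n - μ.2.2 + μ.2.1 ≤ n + 1 ∧ (0 : ℝ) ≤ μ.2.2 := by
      rcases hμ' with rfl | rfl | rfl | rfl <;> simp <;> linarith
    obtain ⟨ha1, ha2, hb1, hb2, hμ3⟩ := hab
    set a : ℤ := n - μ.2.2 + μ.1
    set b : ℤ := n - μ.2.2 + μ.2.1
    have hΛ : (1 + ε₀) ^ ((5 : ℝ) * (n - μ.2.2) / 2) ≤ (1 + ε₀) ^ ((5 : ℝ) * n / 2) :=
      Real.rpow_le_rpow_of_exponent_le hq1 (by nlinarith)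
    have hΛ0 : 0 ≤ (1 + ε₀) ^ ((5 : ℝ) * (n - μ.2.2) / 2) := (Real.rpow_pos_of_pos hq _).le
    have hin : D a * A b + A a * D b ≤ 2 * Amax * Dmax := by
      have h1 : D a * A b ≤ Dmax * Amax :=
        mul_le_mul (hD3 a ha1 ha2) (hA3 b hb1 hb2) (hA0 b) ((hD0 a).trans (hD3 a ha1 ha2))
      have h2 : A a * D b ≤ Amax * Dmax :=
        mul_le_mul (hA3 a ha1 ha2) (hD3 b hb1 hb2) (hD0 b) ((hA0 a).trans (hA3 a ha1 ha2))
      linarith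
    have hin0 : 0 ≤ D a * A b + A a * D b := by
      have := hA0 a; have := hA0 b; have := hD0 a; have := hD0 b; positivity
    rw [mul_assoc]
    refine mul_le_mul_of_nonneg_left ?_ (abs_nonneg _)
    exact mul_le_mul hΛ hin hin0 (hΛ0.trans hΛ)
  calc ∑ i₁, ∑ i₂, ∑ μ ∈ shiftSet, |α i₁ i₂ i μ| * (1 + ε₀) ^ ((5 : ℝ) * (n - μ.2.2) / 2) *
          (D (n - μ.2.2 + μ.1) * A (n - μ.2.2 + μ.2.1) +
            A (n - μ.2.2 + μ.1) * D (n - μ.2.2 + μ.2.1))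
      ≤ ∑ i₁, ∑ i₂, ∑ μ ∈ shiftSet,
          |α i₁ i₂ i μ| * ((1 + ε₀) ^ ((5 : ℝ) * n / 2) * (2 * Amax * Dmax)) :=
        Finset.sum_le_sum fun i₁ _ => Finset.sum_le_sum fun i₂ _ =>
          Finset.sum_le_sum fun μ hμ => hterm i₁ i₂ μ hμ
    _ = 2 * (∑ i₁, ∑ i₂, ∑ μ ∈ shiftSet, |α i₁ i₂ i μ|) * (1 + ε₀) ^ ((5 : ℝ) * n / 2) *
          Amax * Dmax := by
        simp only [← Finset.sum_mul]
        ring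

/-- The total size of the structure constants with output mode `i` is at most `m·m·4` for a table with
entries of modulus `≤ 1` on the shift set (e.g. `InTableClass`). [cite: Tao2016AveragedNS, §4 (4.1)–(4.2)] -/
theorem sum_abs_coeff_le {α : Fin m → Fin m → Fin m → ℤ × ℤ × ℤ → ℝ}
    (hα : ∀ (i₁ i₂ i₃ : Fin m) (μ : ℤ × ℤ × ℤ), μ ∈ shiftSet → |α i₁ i₂ i₃ μ| ≤ 1) (i : Fin m) :
    ∑ i₁, ∑ i₂, ∑ μ ∈ shiftSet, |α i₁ i₂ i μ| ≤ (m : ℝ) * m * 4 := by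
  calc ∑ i₁, ∑ i₂, ∑ μ ∈ shiftSet, |α i₁ i₂ i μ| ≤ ∑ _i₁ : Fin m, ∑ _i₂ : Fin m, ∑ _μ ∈ shiftSet, (1 : ℝ) :=
        Finset.sum_le_sum fun i₁ _ => Finset.sum_le_sum fun i₂ _ => Finset.sum_le_sum fun μ hμ =>
          hα i₁ i₂ i μ hμ
    _ = (m : ℝ) * m * 4 := by
        simp [shiftSet, Finset.card_univ]
        ring

end GappedFrontRobust

end Summit.NavierStokesRegularity.NavierStokesRegularity.Theorems

end
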